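import Literature.NumberTheory.Automorphic.QuaternionAlgebraAdelic
import Mathlib.RingTheory.MatrixAlgebra
import Mathlib.Topology.Instances.Matrix
import Mathlib.Topology.Algebra.ContinuousMonoidHom
import HarnessLib

/-!
# The two models of `GL_n` over the adeles: `(𝔸_K ⊗_K M_n(K))ˣ ≃ₜ* GL_n(𝔸_K)`
(Vignéras, *Arithmétique des algèbres de quaternions*, LNM 800 (1980), Ch. I §2 Cor. 2.4 and
Ch. III §1: `H_𝔸 = 𝔸 ⊗ H`, `M(2, K)_𝔸 = M(2, 𝔸)`; Gelbart, *Automorphic forms on adele groups*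
(1975), §10, p. 152: "this group is naturally isomorphic to `G_S` via the local isomorphisms `θ_v`")

Topic `NumberTheory/Automorphic`. Definitions (`ScalarExtension.matrixAlgEquiv`,
`glAdelicUnitsEquiv`, `AdelicGroupData.unitsMatrixEquivGl`) and theorems; no named fact, no
instance.

The tree carries two honest models of the adelic group of `GL_n` over a number field `K`:

* `AdelicGroupData.gl n K` (`AdelicGroupData`): `Adelic = GL (Fin n) (AdeleRing (𝓞 K) K)` with
  its units-of-matrices topology, `toAdelic = GL_n(algebraMap K 𝔸_K)`, `center' = posRealScalar`;
* `AdelicGroupData.units K (Matrix (Fin n) (Fin n) K)` (`QuaternionAlgebraAdelic`): `Adelic =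
  (𝔸_K ⊗_K M_n(K))ˣ` for the `𝔸_K`-module topology on the scalar extension, `toAdelic = inclAdelic`
  (`x ↦ 1 ⊗ x`), `center' = posRealCentral` — the model in which the quaternionic side of the
  Jacquet–Langlands comparison (`QuaternionUnitsTrace*`, `QuaternionAdelicTorus`, …) is written,
  `M₂(K)` being a quaternion algebra (`isQuaternionAlgebra_matrix`).

This file identifies them:

* `ScalarExtension.matrixAlgEquiv K R n : R ⊗_K M_n(K) ≃ₐ[R] M_n(R)` — the explicit `R`-algebra
  isomorphism (Mathlib's `K`-linear `matrixEquivTensor`, upgraded as in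
  `ScalarExtension.nonempty_algEquiv_matrix`), with `matrixAlgEquiv (r ⊗ M) = r • M`
  (`matrixAlgEquiv_tmul`, `matrixAlgEquiv_incl`, `matrixAlgEquiv_algebraMap`);
* `isModuleTopology_matrix`, `continuous_matrixAlgEquiv`, `continuous_matrixAlgEquiv_symm` — for a
  topological ring `R` the entrywise topology on `M_n(R)` is the `R`-module topology, so
  `matrixAlgEquiv` is a homeomorphism (linear maps out of a module topology are continuous);
* `glAdelicUnitsEquiv K n : (𝔸_K ⊗_K M_n(K))ˣ ≃ₜ* GL_n(𝔸_K)` — **the isomorphism of topological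
  groups between the two models**, with `glAdelicUnitsEquiv (inclAdelic x) = (gl n K).toAdelic x`
  (`glAdelicUnitsEquiv_inclAdelic`; note `(M_n(K))ˣ = GL_n(K)` definitionally),
  `glAdelicUnitsEquiv (posRealCentral t) = posRealScalar n K t` (`glAdelicUnitsEquiv_posRealCentral`);
* `AdelicGroupData.unitsMatrixEquivGl K n : (units K (M_n K)).Adelic ≃ₜ* (gl n K).Adelic` — the same
  isomorphism keyed on the two adelic group data, with `unitsMatrixEquivGl_toAdelic`,
  `map_center'_unitsMatrix` (`map (A_G) = A_G`), `map_arithmeticSubgroup_unitsMatrix`,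
  **`map_quotientSubgroup_unitsMatrix` (`map (ℝ_{>0} · M_n(K)ˣ) = ℝ_{>0} · GL_n(K)`)**,
  `unitsMatrixEquivGl_mem_quotientSubgroup_iff` and `comap_quotientSubgroup_gl_unitsMatrix`.

So every statement about the datum `units K (M_n K)` transports to `gl n K` (automorphic
quotients correspond through `InvariantQuotientTransport.cosetCongrHomeomorph`). A brick of the
inline (D-0026) decomposition of
`Literature.NumberTheory.Automorphic.strong_multiplicity_one_quaternionUnits` (Gelbart Thm. 10.5):
the `GL(2)` side of the comparison (10.14) = (10.15) lives on `gl 2 K`, the tori come from the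
tensor model.

## References

* M.-F. Vignéras, *Arithmétique des algèbres de quaternions*, LNM 800 (1980), Ch. I §2 Cor. 2.4,
  Ch. III §1 [VignerasLNM800].
* S. Gelbart, *Automorphic forms on adele groups*, Ann. of Math. Studies 83 (1975), §10, p. 152
  [Gelbart1975].
-/

noncomputable section

open scoped TensorProduct NNReal
open NumberField IsDedekindDomain

namespace Literature.NumberTheory.Automorphic

/-! ### The `R`-algebra isomorphism `R ⊗_K M_n(K) ≃ M_n(R)` -/

section BaseChange

variable (K : Type*) [Field K] (R : Type*) [CommRing R] [Algebra K R]
  (n : Type*) [Fintype n] [DecidableEq n]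

/-- **Base change of a matrix algebra, explicitly**: `R ⊗_K M_n(K) ≃ₐ[R] M_n(R)`, `r ⊗ M ↦ r • M`.
Mathlib's `matrixEquivTensor n K R : M_n(R) ≃ₐ[K] R ⊗_K M_n(K)` is only `K`-linear; its inverse maps
the structure map `r ↦ r ⊗ 1` to `r ↦ r • 1`, so it is an `R`-algebra isomorphism
(`AlgEquiv.ofRingEquiv`; cf. `ScalarExtension.nonempty_algEquiv_matrix`). Vignéras I §2 Cor. 2.4.
[folklore] -/
def ScalarExtension.matrixAlgEquiv : ScalarExtension K R (Matrix n n K) ≃ₐ[R] Matrix n n R :=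
  (ScalarExtension.ofTensor K R (Matrix n n K)).symm.trans
    (AlgEquiv.ofRingEquiv (f := (matrixEquivTensor n K R).symm.toRingEquiv) fun r ↦ by
      change (matrixEquivTensor n K R).symm (algebraMap R (R ⊗[K] Matrix n n K) r) = _
      rw [Algebra.TensorProduct.algebraMap_apply, Algebra.algebraMap_self, RingHom.id_apply,
        matrixEquivTensor_apply_symm, Matrix.map_one _ (map_zero _) (map_one _),
        Algebra.algebraMap_eq_smul_one])

/-- `matrixAlgEquiv (r ⊗ M) = r • M` (entries of `M` mapped into `R`). [folklore] -/
@[simp]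
theorem ScalarExtension.matrixAlgEquiv_tmul (r : R) (M : Matrix n n K) :
    ScalarExtension.matrixAlgEquiv K R n (ScalarExtension.ofTensor K R (Matrix n n K) (r ⊗ₜ[K] M)) =
      r • M.map (algebraMap K R) :=
  matrixEquivTensor_apply_symm (n := n) K R r M

/-- `matrixAlgEquiv (1 ⊗ M) = M` with entries mapped into `R`: the diagonal embedding
`M_n(K) → M_n(R)`. [folklore] -/
@[simp]
theorem ScalarExtension.matrixAlgEquiv_incl (M : Matrix n n K) :
    ScalarExtension.matrixAlgEquiv K R n (ScalarExtension.incl K R (Matrix n n K) M) =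
      M.map (algebraMap K R) := by
  rw [ScalarExtension.incl_apply, ScalarExtension.matrixAlgEquiv_tmul, one_smul]

/-- `matrixAlgEquiv` maps the scalar `r` to the scalar matrix `r • 1`. [folklore] -/
theorem ScalarExtension.matrixAlgEquiv_algebraMap (r : R) :
    ScalarExtension.matrixAlgEquiv K R n (algebraMap R (ScalarExtension K R (Matrix n n K)) r) =
      algebraMap R (Matrix n n R) r :=
  AlgEquiv.commutes _ r

variable [TopologicalSpace R] [IsTopologicalRing R]

omit [DecidableEq n] in
/-- The entrywise (product) topology on `M_n(R)` is the `R`-module topology (a finite product of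
copies of `R`; Mathlib `IsModuleTopology.instPi`). [folklore] -/
theorem isModuleTopology_matrix : IsModuleTopology R (Matrix n n R) :=
  inferInstanceAs (IsModuleTopology R (n → n → R))

/-- `matrixAlgEquiv : R ⊗_K M_n(K) → M_n(R)` is continuous (an `R`-linear map out of the module
topology). [folklore] -/
theorem ScalarExtension.continuous_matrixAlgEquiv :
    Continuous (ScalarExtension.matrixAlgEquiv K R n) :=
  IsModuleTopology.continuous_of_linearMap (ScalarExtension.matrixAlgEquiv K R n).toLinearMap

/-- The inverse `M_n(R) → R ⊗_K M_n(K)` is continuous (`M_n(R)` carries the module topology,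
`isModuleTopology_matrix`). [folklore] -/
theorem ScalarExtension.continuous_matrixAlgEquiv_symm :
    Continuous (ScalarExtension.matrixAlgEquiv K R n).symm := by
  haveI := isModuleTopology_matrix R n
  exact IsModuleTopology.continuous_of_linearMap (ScalarExtension.matrixAlgEquiv K R n).symm.toLinearMap

end BaseChange

/-! ### The units: `(𝔸_K ⊗_K M_n(K))ˣ ≃ₜ* GL_n(𝔸_K)` -/

section NumberField

variable (K : Type) [Field K] [NumberField K] (n : ℕ)

/-- **The two adelic models of `GL_n` are isomorphic topological groups**:
`(𝔸_K ⊗_K M_n(K))ˣ ≃ₜ* GL_n(𝔸_K)` (units of the topological `𝔸_K`-algebra isomorphism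
`matrixAlgEquiv`; Vignéras III §1, `M(2,K)_𝔸 = M(2, 𝔸)`). [folklore] -/
def glAdelicUnitsEquiv :
    adelicUnits K (Matrix (Fin n) (Fin n) K) ≃ₜ* GL (Fin n) (AdeleRing (𝓞 K) K) :=
  { Units.mapEquiv (ScalarExtension.matrixAlgEquiv K (AdeleRing (𝓞 K) K) (Fin n)).toMulEquiv with
    continuous_toFun := by
      change Continuous (Units.map
        (ScalarExtension.matrixAlgEquiv K (AdeleRing (𝓞 K) K) (Fin n)).toMulEquiv.toMonoidHom)
      exact Units.continuous_map
        (ScalarExtension.continuous_matrixAlgEquiv K (AdeleRing (𝓞 K) K) (Fin n))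
    continuous_invFun := by
      change Continuous (Units.map
        (ScalarExtension.matrixAlgEquiv K (AdeleRing (𝓞 K) K) (Fin n)).toMulEquiv.symm.toMonoidHom)
      exact Units.continuous_map
        (ScalarExtension.continuous_matrixAlgEquiv_symm K (AdeleRing (𝓞 K) K) (Fin n)) }

/-- On underlying matrices `glAdelicUnitsEquiv` is `matrixAlgEquiv` (definitional). [folklore] -/
@[simp]
theorem coe_glAdelicUnitsEquiv (u : adelicUnits K (Matrix (Fin n) (Fin n) K)) :
    ((glAdelicUnitsEquiv K n u : GL (Fin n) (AdeleRing (𝓞 K) K)) : Matrix (Fin n) (Fin n) (AdeleRing (𝓞 K) K)) =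
      ScalarExtension.matrixAlgEquiv K (AdeleRing (𝓞 K) K) (Fin n)
        (u : ScalarExtension K (AdeleRing (𝓞 K) K) (Matrix (Fin n) (Fin n) K)) := rfl

/-- **Compatibility with the rational points**: `glAdelicUnitsEquiv (1 ⊗ x) = GL_n(algebraMap) x`,
i.e. `glAdelicUnitsEquiv ∘ inclAdelic = (gl n K).toAdelic` on `M_n(K)ˣ = GL_n(K)`. [folklore] -/
theorem glAdelicUnitsEquiv_inclAdelic (x : (Matrix (Fin n) (Fin n) K)ˣ) :
    glAdelicUnitsEquiv K n (inclAdelic K (Matrix (Fin n) (Fin n) K) x) =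
      Matrix.GeneralLinearGroup.map (algebraMap K (AdeleRing (𝓞 K) K)) x := by
  refine Units.ext ?_
  rw [coe_glAdelicUnitsEquiv]
  change ScalarExtension.matrixAlgEquiv K (AdeleRing (𝓞 K) K) (Fin n)
      (ScalarExtension.incl K (AdeleRing (𝓞 K) K) (Matrix (Fin n) (Fin n) K) (x : Matrix (Fin n) (Fin n) K)) =
    (Matrix.GeneralLinearGroup.map (algebraMap K (AdeleRing (𝓞 K) K)) x : Matrix (Fin n) (Fin n) _)
  rw [ScalarExtension.matrixAlgEquiv_incl]
  rfl

/-- **Compatibility with the split centre**: `glAdelicUnitsEquiv (posRealCentral t) = posRealScalar n K t`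
(both are the scalar matrix of the idele `posRealIdele K t`). [folklore] -/
theorem glAdelicUnitsEquiv_posRealCentral (t : ℝ≥0ˣ) :
    glAdelicUnitsEquiv K n (posRealCentral K (Matrix (Fin n) (Fin n) K) t) = posRealScalar n K t := by
  refine Units.ext ?_
  rw [coe_glAdelicUnitsEquiv]
  change ScalarExtension.matrixAlgEquiv K (AdeleRing (𝓞 K) K) (Fin n)
      (algebraMap (AdeleRing (𝓞 K) K) _ ((posRealIdele K t : (AdeleRing (𝓞 K) K)ˣ) : AdeleRing (𝓞 K) K)) =
    ((Matrix.GeneralLinearGroup.scalar (Fin n) (posRealIdele K t) : GL (Fin n) (AdeleRing (𝓞 K) K)) :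
      Matrix (Fin n) (Fin n) (AdeleRing (𝓞 K) K))
  rw [ScalarExtension.matrixAlgEquiv_algebraMap, Matrix.GeneralLinearGroup.coe_scalar,
    Matrix.algebraMap_eq_diagonal, Matrix.scalar_apply]
  rfl

/-! ### Keyed on the adelic group data: `(units K (M_n K)).Adelic ≃ₜ* (gl n K).Adelic` -/

/-- **The model isomorphism keyed on the two adelic group data** (statements about subgroups of
the data — `center'`, `arithmeticSubgroup`, `quotientSubgroup` — are phrased through this copy
of `glAdelicUnitsEquiv`, so that they elaborate with the data's own instances). [folklore] -/
def AdelicGroupData.unitsMatrixEquivGl :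
    (AdelicGroupData.units K (Matrix (Fin n) (Fin n) K)).Adelic ≃ₜ* (AdelicGroupData.gl n K).Adelic :=
  glAdelicUnitsEquiv K n

/-- `unitsMatrixEquivGl` is `glAdelicUnitsEquiv` (definitional). [folklore] -/
theorem AdelicGroupData.unitsMatrixEquivGl_apply
    (u : (AdelicGroupData.units K (Matrix (Fin n) (Fin n) K)).Adelic) :
    AdelicGroupData.unitsMatrixEquivGl K n u = glAdelicUnitsEquiv K n u := rfl

/-- **Compatibility with the rational points**, keyed form:
`unitsMatrixEquivGl ∘ (units K (M_n K)).toAdelic = (gl n K).toAdelic` (the rational groups of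
both data are `M_n(K)ˣ = GL_n(K)`). [folklore] -/
theorem AdelicGroupData.unitsMatrixEquivGl_toAdelic
    (x : (AdelicGroupData.units K (Matrix (Fin n) (Fin n) K)).Rational) :
    AdelicGroupData.unitsMatrixEquivGl K n ((AdelicGroupData.units K (Matrix (Fin n) (Fin n) K)).toAdelic x) =
      (AdelicGroupData.gl n K).toAdelic x :=
  glAdelicUnitsEquiv_inclAdelic K n x

/-- `unitsMatrixEquivGl` carries `A_G = ℝ_{>0}` of the tensor model onto `A_G` of `gl n K`. [folklore] -/
theorem AdelicGroupData.map_center'_unitsMatrix :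
    (AdelicGroupData.units K (Matrix (Fin n) (Fin n) K)).center'.map
        (AdelicGroupData.unitsMatrixEquivGl K n).toMonoidHom = (AdelicGroupData.gl n K).center' := by
  ext g
  constructor
  · intro hg
    obtain ⟨u, hu, rfl⟩ := Subgroup.mem_map.1 hg
    obtain ⟨t, rfl⟩ : ∃ t, posRealCentral K (Matrix (Fin n) (Fin n) K) t = u := hu
    exact ⟨t, (glAdelicUnitsEquiv_posRealCentral K n t).symm⟩
  · intro hg
    obtain ⟨t, rfl⟩ : ∃ t, posRealScalar n K t = g := hg
    exact Subgroup.mem_map.2 ⟨posRealCentral K _ t, ⟨t, rfl⟩, glAdelicUnitsEquiv_posRealCentral K n t⟩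

/-- `unitsMatrixEquivGl` carries `M_n(K)ˣ` (diagonally embedded) onto `GL_n(K) ≤ GL_n(𝔸_K)`. [folklore] -/
theorem AdelicGroupData.map_arithmeticSubgroup_unitsMatrix :
    (AdelicGroupData.units K (Matrix (Fin n) (Fin n) K)).arithmeticSubgroup.map
        (AdelicGroupData.unitsMatrixEquivGl K n).toMonoidHom =
      (AdelicGroupData.gl n K).arithmeticSubgroup := by
  ext g
  constructor
  · intro hg
    obtain ⟨u, hu, rfl⟩ := Subgroup.mem_map.1 hg
    obtain ⟨x, rfl⟩ : ∃ x, (AdelicGroupData.units K (Matrix (Fin n) (Fin n) K)).toAdelic x = u := hu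
    exact ⟨x, (glAdelicUnitsEquiv_inclAdelic K n x).symm⟩
  · intro hg
    obtain ⟨x, rfl⟩ : ∃ x, (AdelicGroupData.gl n K).toAdelic x = g := hg
    exact Subgroup.mem_map.2 ⟨(AdelicGroupData.units K (Matrix (Fin n) (Fin n) K)).toAdelic x,
      ⟨x, rfl⟩, glAdelicUnitsEquiv_inclAdelic K n x⟩

/-- **`unitsMatrixEquivGl` carries `ℝ_{>0} · M_n(K)ˣ` onto `ℝ_{>0} · GL_n(K)`**: the subgroups
divided out in the two automorphic quotients correspond. [folklore] -/
theorem AdelicGroupData.map_quotientSubgroup_unitsMatrix :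
    (AdelicGroupData.units K (Matrix (Fin n) (Fin n) K)).quotientSubgroup.map
        (AdelicGroupData.unitsMatrixEquivGl K n).toMonoidHom =
      (AdelicGroupData.gl n K).quotientSubgroup := by
  change ((AdelicGroupData.units K (Matrix (Fin n) (Fin n) K)).center' ⊔
      (AdelicGroupData.units K (Matrix (Fin n) (Fin n) K)).arithmeticSubgroup).map _ =
    (AdelicGroupData.gl n K).center' ⊔ (AdelicGroupData.gl n K).arithmeticSubgroup
  rw [Subgroup.map_sup, AdelicGroupData.map_center'_unitsMatrix,
    AdelicGroupData.map_arithmeticSubgroup_unitsMatrix]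

/-- `unitsMatrixEquivGl u ∈ ℝ_{>0} GL_n(K) ↔ u ∈ ℝ_{>0} M_n(K)ˣ`. [folklore] -/
theorem AdelicGroupData.unitsMatrixEquivGl_mem_quotientSubgroup_iff
    (u : (AdelicGroupData.units K (Matrix (Fin n) (Fin n) K)).Adelic) :
    AdelicGroupData.unitsMatrixEquivGl K n u ∈ (AdelicGroupData.gl n K).quotientSubgroup ↔
      u ∈ (AdelicGroupData.units K (Matrix (Fin n) (Fin n) K)).quotientSubgroup := by
  rw [← AdelicGroupData.map_quotientSubgroup_unitsMatrix]
  constructor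
  · intro hu
    obtain ⟨v, hv, hvu⟩ := Subgroup.mem_map.1 hu
    have : v = u := (AdelicGroupData.unitsMatrixEquivGl K n).injective hvu
    rwa [← this]
  · intro hu
    exact Subgroup.mem_map.2 ⟨u, hu, rfl⟩

/-- The preimage form: `ℝ_{>0} GL_n(K)` pulled back along `unitsMatrixEquivGl` is `ℝ_{>0} M_n(K)ˣ`.
[folklore] -/
theorem AdelicGroupData.comap_quotientSubgroup_gl_unitsMatrix :
    (AdelicGroupData.gl n K).quotientSubgroup.comap (AdelicGroupData.unitsMatrixEquivGl K n).toMonoidHom =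
      (AdelicGroupData.units K (Matrix (Fin n) (Fin n) K)).quotientSubgroup := by
  ext u
  rw [Subgroup.mem_comap]
  exact AdelicGroupData.unitsMatrixEquivGl_mem_quotientSubgroup_iff K n u

end NumberField

end Literature.NumberTheory.Automorphic
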